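import Summits.ResolutionOfSingularities.ResolutionOfSingularities.Theses.MarkedTransfer
import Summits.ResolutionOfSingularities.ResolutionOfSingularities.Theorems.MarkedTransferCampaignW46HostLadder
import HarnessLib

/-!
# [OURS · L1 W4.6 rung (ii)] CALIBRATION LEAF: the host-shape ladder at `d = 3` IS the route item stmt-16156

The ONE place where the OURS ladder `CampaignW46.HypersurfaceOrderReductionDimLE p d` (module `…W46HostLadder.lean`,
route-independent) meets the route file `Theses/MarkedTransfer.lean`: `HypersurfaceOrderReductionDimLeThree` (the support item
stmt-ResolutionOfSingularities-16156, which quantifies the prime INSIDE) `↔ ∀ p, HypersurfaceOrderReductionDimLE p 3` — by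
unfolding and the numeral cast `((3 : ℕ) : WithBot ℕ∞) = 3`, nothing else; and the corollary «host item ⇒ every rung `d ≤ 3`».
A LEAF: nobody but provers' closers should import it (gate rule «theses-cone»). Nothing here is a statement of the manuscript;
the route item enters only as one side of an `Iff` / a hypothesis. Typed by res-L1-type-o1 (gen 6, 2026-08-27) with the module,
on res-D-pv-047 AS res-L1-s46-pv-10's WORD 05:10:19Z. `--supports stmt-ResolutionOfSingularities-16156 --as helper`.
AI-WRITTEN; NO expert review; AI review is weaker than expert review.
-/

noncomputable section

set_option linter.dupNamespace false -- mandated namespace of this single-conjunct summit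

namespace Summit.ResolutionOfSingularities.ResolutionOfSingularities.Theorems

namespace CampaignW46

/-- **CALIBRATION**: the route item `HypersurfaceOrderReductionDimLeThree` (stmt-16156) is exactly «every rung `d = 3` of the
host-shape ladder», `∀ p, HypersurfaceOrderReductionDimLE p 3` (unfolding + the numeral cast). [folklore] -/
theorem hypersurfaceOrderReductionDimLeThree_iff_forall :
    Theses.MarkedTransfer.HypersurfaceOrderReductionDimLeThree ↔ ∀ p : ℕ, HypersurfaceOrderReductionDimLE p 3 := by
  simp only [Theses.MarkedTransfer.HypersurfaceOrderReductionDimLeThree, HypersurfaceOrderReductionDimLE, Nat.cast_ofNat]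

/-- Pure logic: the route item gives every rung `d ≤ 3` of the host-shape ladder (curves, surfaces, threefolds), at every
prime. [folklore] -/
theorem hypersurfaceOrderReductionDimLE_of_dimLeThree (h : Theses.MarkedTransfer.HypersurfaceOrderReductionDimLeThree)
    (p : ℕ) {d : ℕ} (hd : d ≤ 3) : HypersurfaceOrderReductionDimLE p d :=
  HypersurfaceOrderReductionDimLE.of_le hd (hypersurfaceOrderReductionDimLeThree_iff_forall.mp h p)

/-- Pure logic: conversely, the rungs `d = 3` at every prime give the route item. [folklore] -/
theorem hypersurfaceOrderReductionDimLeThree_of_forall (h : ∀ p : ℕ, HypersurfaceOrderReductionDimLE p 3) :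
    Theses.MarkedTransfer.HypersurfaceOrderReductionDimLeThree :=
  hypersurfaceOrderReductionDimLeThree_iff_forall.mpr h

end CampaignW46

end Summit.ResolutionOfSingularities.ResolutionOfSingularities.Theorems

end
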